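/-
Copyright (c) 2026 the pub-hodgecm-mathlib formalisation cell (harness21).  Prover seat hodgecm-mathlib-K2E4-p11 (g2), Track B ∕ K2-LIT
(build stream 29), h413 = `stmt-HodgeConjecture-24833`, engine E2 line `K2_E2_ThetaExhaustionByRigidity`, unit CAPTURE, socket #20a
«ARCH-PAIR-HOLCOT» — helper (H2) «FRAME TRANSPORT OF PAIR-HOLCOT», part 2 of 2 (deal K2E2-plan (g2) 2026-09-03T23:34:30Z; line lead K2E2-p12 (g2)).  2026-09-04.
-/
import Summits.HodgeConjecture.HodgeConjecture.Theorems.K2E2CapLineFrameTransportOperator  -- ★ (this seat, part 1): `exists_lineFrameTransportOperator`, `lineThetaLiftFun_eq_of_intertwiner`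
import Summits.HodgeConjecture.HodgeConjecture.Theorems.K2E2CapHolThetaWitnessOfHolPair      -- ★ p854893: the Capture vocabulary (`lineThetaKernelDatum`, `JW`, `charCM`, …) — as ★ `K2E2CapArchRowsAllDataOfPairHolCot`
import Summits.HodgeConjecture.HodgeConjecture.Theorems.F0P2sThetaPairsCotForms              -- ★ `holCotForms`, `cmArchSection`, `cmCompactFactor`
import Summits.HodgeConjecture.HodgeConjecture.Theorems.F0P2tThetaPairNeZeroOfFrame          -- ★ `HodgeCM.Model.HypCensus.archWeilRep`, `schwartzReindexCLM`
import Literature.AlgebraicGeometry.Liu2021.AdmissibleElement                                -- ★ `IsAdmissibleElement`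
import Literature.NumberTheory.Automorphic.Liu2021.ThetaLiftFromLineFrame                   -- ★ `cmAdelicFrameTransport`, `coe_cmAdelicFrameTransport`, `compactSpace_quotient_diagonalFrame`
import Literature.NumberTheory.Automorphic.Liu2021.ThetaLiftFromLineMajorantsOfFrame        -- ★ `hasThetaMajorants_lineThetaKernelDatum_of_frame`
import Literature.NumberTheory.Automorphic.AdelicCongruenceArchFinCompat                    -- ★ `finAdelicCongr` (the source frame's finite-adelic transport)
import Literature.NumberTheory.Automorphic.SchwartzBruhatCosetIndicator                      -- ★ `indicator_thinCoset_mem_schwartzBruhat` (a non-zero finite test function)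
import HarnessLib

-- As in the lineage (★ `ThetaLiftFromLineSeamTransport`, ★ `K2E2CapArchRowsAllDataOfPairHolCot`): the theta-kernel datum's types are very large; elaborate sequentially.
set_option Elab.async false

/-!
# K2 ∕ E2 «ThetaExhaustionByRigidity», unit CAPTURE, socket #20a — (H2) FRAME TRANSPORT OF «ARCH-PAIR-HOLCOT»:
# the clause at ONE diagonal frame `(e, d_V′, g′)` of `H` implies it at EVERY diagonal frame `(e₁, d_V, g)` of `H`

Cell `hodgecm-mathlib` (FLOOR 0), Track B «K2-LIT», engine E2, crux item H413 = `stmt-HodgeConjecture-24833` (route of record `HCCMUnconditional`,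
no route verbs).  Socket of record: #20a `sig_K2E2CapArchPairHolCot` «ARCH-PAIR-HOLCOT» (bytes `K2/K2E2-p12/g2/ARCH-PAIR-HOLCOT.txt` 3efc5e019e17f8df) of the line
`Cruxes/H413/Lines/K2_E2_ThetaExhaustionByRigidity.lean`; line lead K2E2-p12 (g2) (STRUCTURE 2026-09-03T23:32:20Z: H1a ∕ H1′ ∕ H3 at the PACKAGED frame,
H2 = this file, H4 = orientation mirror, CLOSER = `K2E2CapArchPairHolCot`).  Author K2E4-p11 (g2).  `--supports stmt-HodgeConjecture-24833 --as helper`;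
THEOREMS ONLY (no `def`, no `instance`, no notation, no `sorry`); imports ★ only (no `Lines`).

WHAT IS PROVED.  **`capArchPairHolCot_frameTransport`** — (H2): for a CM frame `(L, ι, H, T)` definite off `ι` with `[L⁺:ℚ] ≥ 2`, the #20a clause at ONE
diagonal frame `(e, d_V′, g′)` of `H` (hypothesis `hsrc` = the clause's tail from its `ιV` binder on, tokens primed) implies the clause at EVERY `(e₁, d_V, g)`
(conclusion = the clause's tail from `∀ {n'} (e₁ …)` on, VERBATIM; line lead «=» 23:51:16Z, K2E2-r01 pre-box 23:52:20Z: 0 diff).  So the CLOSER proves the clause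
at the packaged frame `(ArchSideTerm.e₁, frameD V, frameG V)` only (H1′ + H3) and applies this theorem.  Part 1 (★ `K2E2CapLineFrameTransportOperator`) supplies
the operator `R` and the pointwise identity of theta lifts.

THE PROOF (all inputs ★).  `B := g′⁻¹ g` is a rational isometry `ᵗ(c̄B)·diag d_V′·B = diag d_V`; `θ_V := Ad(B⁻¹ ⊗ 1)` (★ `adelicIsometryConj (aOfB B)`) satisfies
`θ_V ∘ (g′_𝔸⁻¹ · g′_𝔸) = g_𝔸⁻¹ · g_𝔸` on `U(H)(𝔸)` (★ `coe_cmAdelicFrameTransport`).  The operator `R := R_{e⁻¹e₁} ∘ R_e ∘ ω(r_Kron) ∘ R_e⁻¹`, `r_Kron = r_{L⁺}(h₀)` Weil's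
Θ-fixing rational lift of the see-saw element of `B⁻¹ ⊗ 1` (★ `rKron`), fixes `Θ` (★ `thetaDist_omega_ratPointsThetaLiftCont`, ★ `thetaDistLM_piSBReindex`) and
intertwines `pairRep[e, d_V′] → pairRep[e₁, d_V]` over `(θ_V, id)`: at the enumeration `e` this is ★ `hω_of_T4` (the HYPOTHESIS-FREE doubled isometry transport ★
`conjSplitting_doubledWeilRep_comp_thetaD`, [Kudla1994, Thm. 3.1]) read at the line through ★ `omega_pairSplitting_chiSplittingLine` — the operator block of ★
`MeetsThetaLiftFromLine.frameTransport` token for token —, and the re-enumeration `e ↦ e₁` is ★ `omega_chiSplitting_reindex`.  By §1 the theta-lift FUNCTION on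
`U(H)(𝔸)` at `(e₁, d_V, g)` with test vector `RΦ` IS the one at `(e, d_V′, g′)` with test vector `Φ` (same `μ_W`, same weight `χ̃_χ`).  `ω(r_Kron)` is a pure tensor
operator `A ⊗ Q` on pure tensors (★ `exists_omega_tmul_ratPointsThetaLiftCont_realDiagonal`, [Weil1964, n° 38–40]), so `R (R_e(φ ⊗ Φ_f)) = R_{e₁}(Aφ ⊗ QΦ_f)`
(★ `piSBReindex_tmul`); the witnesses are `φ := A ∘ φ′`, `j₀`: (HOLCOT) at `Φ_f` is the source membership at `Q⁻¹Φ_f` (the SAME function on `U(H)(𝔸)`),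
`R^∞_{e₁}(Aφ′_{j₀}) ≠ 0` by injectivity of `R^∞_{e₁}` and `A`, and (E) is the intertwining identity at `(1, a′_∞)` on the pure tensor `R_e(φ′_{j₀} ⊗ f₀)`, `f₀ ≠ 0` the
indicator of `(𝒪̂)^{3×1}` (★ `indicator_thinCoset_mem_schwartzBruhat`): by ★ `omega_pairSplitting_arch_map_tmul` both sides are pure tensors with the same non-zero
finite factor, which cancels pointwise (★ `coe_piSchwartzBruhatEquiv_tmul`, ★ `piAdeleSplit`).  The source frame's side conditions are ★: compactness
`compactSpace_quotient_diagonalFrame`, majorants `hasThetaMajorants_lineThetaKernelDatum_of_frame`, finite-adelic transport `(finAdelicCongr g′ …)⁻¹`.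

HONEST LABEL.  HC_CM is proved only modulo the 7 printed citations (2 remaining named inputs: hLiu418 = stmt-HodgeConjecture-24832, h413 = stmt-HodgeConjecture-24833)
until rung 0 closes; this file is a count-neutral helper of socket #20a (it moves no counter; the CLOSER does, with H1′ ∕ H3 ∕ H4).

## References
* [Liu2021] Y. Liu, *Fourier–Jacobi cycles and arithmetic relative trace formula*, Camb. J. Math. 9 (2021) = arXiv:2102.11518: Def. 4.11 (l. 2092–2096);
  App. D §D.1 Step 1 footnote (l. 5215: «the isomorphism class of `ω(μ, ε, χ)` depends only on `(μ, ε, χ)`»), Steps 2–3 (l. 5217–5221); proof of Prop. 4.13 Case 1.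
* [Weil1964] A. Weil, *Sur certains groupes d'opérateurs unitaires*, Acta Math. 111 (1964), Chap. III n° 38–41, Thm. 6 p. 193.
* [GelbartRogawski1991] S. Gelbart, J. Rogawski, Invent. Math. 105 (1991), §3.1 Prop. 3.1.1 p. 455, Remark p. 457; §3.2 p. 457.
* [Kudla1994] S. Kudla, Israel J. Math. 87 (1994), §2 (doubled space, Siegel parabolic), Thm. 3.1.
* [PlatonovRapinchuk1994] V. Platonov, A. Rapinchuk, *Algebraic Groups and Number Theory* (1994), §5.1, §5.3 Thm. 5.5.
-/

set_option autoImplicit false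
set_option linter.dupNamespace false

noncomputable section

namespace Summit.HodgeConjecture.HodgeConjecture.Cruxes.H413.K2E2CapArchPairFrameTransport

open scoped TensorProduct Matrix Kronecker ComplexOrder ENNReal SchwartzMap Classical Pointwise
open NumberField NumberField.InfinitePlace NumberField.mixedEmbedding IsDedekindDomain MeasureTheory MulAction
open Literature.NumberTheory Literature.NumberTheory.Automorphic Literature.NumberTheory.Automorphic.UnitaryGroup
open Literature.NumberTheory.Automorphic.UnitaryGroup.CotangentForms
open Literature.NumberTheory.Automorphic.Liu2021
open Literature.NumberTheory.Automorphic.Liu2021.Def411WeilCarriers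
open Literature.NumberTheory.Automorphic.Liu2021.Def411WeilCarriersDoubling
open Literature.NumberTheory.Automorphic.IdeleClassGroup
open Literature.NumberTheory.GelbartRogawski1991 Literature.NumberTheory.GelbartRogawski1991.UnitaryDualPair
open Literature.NumberTheory.GelbartRogawski1991.UnitaryDualPair.WeilCoinv
open Literature.NumberTheory.GelbartRogawski1991.GRConstruction
open Literature.NumberTheory.Weil1964
open Literature.RepresentationTheory Literature.RepresentationTheory.Liu2021
open Literature.RepresentationTheory.CompactGroups
open Literature.Geometry.ComplexHyperbolic.BallModel (U21 x₀)
open Literature.AlgebraicGeometry.Liu2021 (IsAdmissibleElement)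
open Summit.HodgeConjecture.CorCM
open Summit.HodgeConjecture.CorCM.Transposition
open Summit.HodgeConjecture.HodgeConjecture.Cruxes.H413
open Summit.HodgeConjecture.HodgeConjecture.Cruxes.H413.K2E2CapLineFrameTransportOperator



-- measured: the #20a clause's STATEMENT alone exceeds 1 600 000 heartbeats (`whnf` of the theta-kernel datum's telescopes), exactly as for
-- ★ `K2E2CapArchRowsAllDataOfPairHolCot` (K2E2-p12), whose budget is copied here; the proof itself is linear rewriting.
set_option synthInstance.maxHeartbeats 400000 in
set_option maxHeartbeats 16000000 in
/-- **(H2) FRAME TRANSPORT OF «ARCH-PAIR-HOLCOT».**  For a CM frame `(L, ι, H, T)` (definite off `ι`, `[L⁺:ℚ] ≥ 2`): if the #20a clause holds at ONE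
diagonal frame `(e, d_V′, g′)` of `H` (`ᵗḡ′ H g′ = diag d_V′`, enumeration `e` of `V ⊗ W`), it holds at EVERY diagonal frame `(e₁, d_V, g)` of `H` — the
theta-lift FUNCTION on `U(H)(𝔸)` read along `g_𝔸⁻¹ · g_𝔸` is the one read along `g′_𝔸⁻¹ · g′_𝔸` for the test vector transported by Weil's Θ-fixing lift
`R = R_{e₁} ∘ ω(r_Kron) ∘ R_e⁻¹` of the rational isometry `B = g′⁻¹ g` (★ `hω_of_T4`, ★ `MeetsThetaLiftFromLine.frameTransport`'s operator identity), `R` is a pure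
tensor operator `A ⊗ Q_f` on pure tensors (★ `exists_omega_tmul_ratPointsThetaLiftCont_realDiagonal`), so `φ := A ∘ φ′` serves: membership in
`holCotForms[ι, T]` is that of the SAME function, `R^∞φ_{j₀} ≠ 0` by injectivity, and (E) is the operator identity at `(1, a′_∞)` read on the archimedean factor.
[cite: Liu2021, Def. 4.11 (l. 2092–2096); App. D §D.1 Steps 1–2 (l. 5215–5219)] [cite: Weil1964, Chap. III n° 41 Thm 6 p. 193]
[cite: GelbartRogawski1991, §3.1 Prop. 3.1.1 p. 455, Remark p. 457] [cite: Kudla1994, §2, Thm. 3.1] -/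
theorem capArchPairHolCot_frameTransport
    (L : Type) [Field L] [NumberField L] [IsCMField L] (ι : L →+* ℂ) (H : Matrix (Fin 3) (Fin 3) L) (T : GL (Fin 3) ℂ)
    (hT : (T : Matrix (Fin 3) (Fin 3) ℂ)ᴴ * H.map ι * (T : Matrix (Fin 3) (Fin 3) ℂ) = Literature.Geometry.ComplexHyperbolic.BallModel.J)
    (hpos : ∀ τ' : L →+* ℂ, InfinitePlace.mk τ' ≠ InfinitePlace.mk ι → (H.map τ').PosDef) (hdeg : 2 ≤ Module.finrank ℚ ↥(maximalRealSubfield L))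
    {n : ℕ} (e : Fin 3 × Fin 1 ≃ Fin n) (dV' : Fin 3 → L) (hdV' : ∀ i, IsCMField.complexConj L (dV' i) = dV' i)
    (hdV'0 : ∀ i, dV' i ≠ 0) (g' : GL (Fin 3) L)
    (hg' : ((g' : Matrix (Fin 3) (Fin 3) L).map (cmConjRingHom L))ᵀ * H * (g' : Matrix (Fin 3) (Fin 3) L) = Matrix.diagonal dV')
    (hsrc : ∀ (ιV : finAdelic (↥(maximalRealSubfield L)) L (IsCMField.complexConj L) 3 H →*
              finAdelic (↥(maximalRealSubfield L)) L (IsCMField.complexConj L) 3 (Matrix.diagonal dV')),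
            (∀ k, ((ιV k : finAdelic (↥(maximalRealSubfield L)) L (IsCMField.complexConj L) 3 (Matrix.diagonal dV')) :
                GL (Fin 3) (FiniteAdeleRing (𝓞 L) L)) =
              (toFinAdeleGL L 3 g')⁻¹ * (k : GL (Fin 3) (FiniteAdeleRing (𝓞 L) L)) * toFinAdeleGL L 3 g') →
          ∀ [CompactSpace (↥(UnitaryGroup.adelic (↥(maximalRealSubfield L)) L (IsCMField.complexConj L) 3 (Matrix.diagonal dV')) ⧸
              (UnitaryGroup.toAdelic (↥(maximalRealSubfield L)) L (IsCMField.complexConj L) 3 (Matrix.diagonal dV')).range)],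
          ∀ (μ : Literature.NumberTheory.Automorphic.IdeleClassGroup L →ₜ* Circle) (hμ : IsConjugateSymplectic L μ), HasWeight L μ 1 →
            ι ∈ hμ.cmType.1 →
          ∀ (a : (↥(maximalRealSubfield L))ˣ) (χ : Chi (↥(maximalRealSubfield L)) L (IsCMField.complexConj L)),
              IsAdmissibleElement L hμ.cmType.1 (algebraMap (↥(maximalRealSubfield L)) L a * (2 * imagUnit L)⁻¹) →
              ∀ (hρ : HasThetaMajorants fun
                  (p : ↥(UnitaryGroup.adelic (↥(maximalRealSubfield L)) L (IsCMField.complexConj L) 3 (Matrix.diagonal dV')) ×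
                    ↥(UnitaryGroup.adelic (↥(maximalRealSubfield L)) L (IsCMField.complexConj L) 1 (JW (↥(maximalRealSubfield L)) L a)))
                  (Φ : piSchwartzBruhat (↥(maximalRealSubfield L)) (Fin n)) =>
                    pairRep (↥(maximalRealSubfield L)) L (IsCMField.complexConj L) 3 1 e (Matrix.diagonal dV') (JW (↥(maximalRealSubfield L)) L a)
                      (chiSplittingLine L e dV' hdV' hdV'0 (toHeckeCharacter L μ) (isUnitary_toHeckeCharacter L μ)
                        ((isOscillatorChar_toHeckeCharacter_iff μ).mpr hμ) (TW (↥(maximalRealSubfield L)) a)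
                        (isUnit_det_TW (↥(maximalRealSubfield L)) a) (JW (↥(maximalRealSubfield L)) L a) (JW_eq (↥(maximalRealSubfield L)) L a))
                      p Φ)
                [MeasurableSpace (↥(UnitaryGroup.adelic (↥(maximalRealSubfield L)) L (IsCMField.complexConj L) 1
                    (JW (↥(maximalRealSubfield L)) L a)) ⧸
                      (UnitaryGroup.toAdelic (↥(maximalRealSubfield L)) L (IsCMField.complexConj L) 1 (JW (↥(maximalRealSubfield L)) L a)).range)]
                [BorelSpace (↥(UnitaryGroup.adelic (↥(maximalRealSubfield L)) L (IsCMField.complexConj L) 1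
                    (JW (↥(maximalRealSubfield L)) L a)) ⧸
                      (UnitaryGroup.toAdelic (↥(maximalRealSubfield L)) L (IsCMField.complexConj L) 1 (JW (↥(maximalRealSubfield L)) L a)).range)]
                (μW : Measure (↥(UnitaryGroup.adelic (↥(maximalRealSubfield L)) L (IsCMField.complexConj L) 1
                  (JW (↥(maximalRealSubfield L)) L a)) ⧸
                    (UnitaryGroup.toAdelic (↥(maximalRealSubfield L)) L (IsCMField.complexConj L) 1 (JW (↥(maximalRealSubfield L)) L a)).range))
                [IsFiniteMeasure μW]
                [SMulInvariantMeasure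
                  (↥(UnitaryGroup.adelic (↥(maximalRealSubfield L)) L (IsCMField.complexConj L) 1 (JW (↥(maximalRealSubfield L)) L a)))
                  (↥(UnitaryGroup.adelic (↥(maximalRealSubfield L)) L (IsCMField.complexConj L) 1 (JW (↥(maximalRealSubfield L)) L a)) ⧸
                    (UnitaryGroup.toAdelic (↥(maximalRealSubfield L)) L (IsCMField.complexConj L) 1 (JW (↥(maximalRealSubfield L)) L a)).range)
                  μW]
                [μW.IsOpenPosMeasure],
              ∃ (φ : Fin 2 → 𝓢(((Fin 3 × Fin 1) → NumberField.mixedEmbedding.mixedSpace ↥(maximalRealSubfield L)), ℂ)) (j₀ : Fin 2),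
                  -- (HOLCOT) every theta pair of `φ` read on `U(H)(𝔸)` along the canonical transport is a HOLOMORPHIC COTANGENT FORM at `(ι, T)` …
                (haveI := normal_range_toAdelic_JW L a
                 ∀ (Φf : FinSB (↥(maximalRealSubfield L)) (Fin 3 × Fin 1)),
                    ((fun (x : (adelicGroupData (↥(maximalRealSubfield L)) L (IsCMField.complexConj L) 3 H).Adelic) (j : Fin 2) =>
                      (lineThetaKernelDatum L 3 e dV' hdV' hdV'0 μ hμ a hρ).thetaLiftFun μW
                        (piSBReindex (↥(maximalRealSubfield L)) e
                          (piSchwartzBruhatEquiv (↥(maximalRealSubfield L)) (Fin 3 × Fin 1) (φ j ⊗ₜ[ℂ] Φf)))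
                        (charCM (chiQuot (↥(maximalRealSubfield L)) L (IsCMField.complexConj L) (Algebra.IsQuadraticExtension.finrank_eq_two _ L)
                          (IsCMField.complexConj_ne_one (K := L)) a χ))
                        ((cmAdelicFrameTransport L 3 H dV' g' hg') x))) ∈
                      CotangentForms.holCotForms (↥(maximalRealSubfield L)) L (IsCMField.complexConj L) 3 H
                        (cmArchSection L ι H T hT) (cmCompactFactor L ι H T hT)) ∧
                  -- … the archimedean vector `R^∞_{e} φ_{j₀}` is non-zero …
                schwartzReindexCLM (↥(maximalRealSubfield L)) e (φ j₀) ≠ 0 ∧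
                  -- (E) … and FIXED by `U(⟨a⟩)(L⁺ ⊗ ℝ)` under the archimedean Weil representation at the `μ`-splitting
                (∀ a' : UnitaryGroup.arch (↥(maximalRealSubfield L)) L (IsCMField.complexConj L) 1 (JW (↥(maximalRealSubfield L)) L a),
                  HodgeCM.Model.HypCensus.archWeilRep (↥(maximalRealSubfield L)) L (IsCMField.complexConj L) 3 1 (Matrix.diagonal dV')
                    (JW (↥(maximalRealSubfield L)) L a) (complexConj_imagUnit L) (imagUnit_ne_zero L) (imagUnit_mul_self L) (realDiagonal_isSymm L dV' hdV')
                    (isSymm_TW (↥(maximalRealSubfield L)) a) (isUnit_det_realDiagonal L dV' hdV' hdV'0) (isUnit_det_TW (↥(maximalRealSubfield L)) a)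
                    (realDiagonal_map L dV' hdV').symm (JW_eq (↥(maximalRealSubfield L)) L a) e
                    (chiSplittingLine L e dV' hdV' hdV'0 (toHeckeCharacter L μ) (isUnitary_toHeckeCharacter L μ)
                      ((isOscillatorChar_toHeckeCharacter_iff μ).mpr hμ) (TW (↥(maximalRealSubfield L)) a)
                      (isUnit_det_TW (↥(maximalRealSubfield L)) a) (JW (↥(maximalRealSubfield L)) L a) (JW_eq (↥(maximalRealSubfield L)) L a))
                    (ThetaNonvanishing.proj_apply_eq_toSp (↥(maximalRealSubfield L)) L (IsCMField.complexConj L) 3 1 e (Matrix.diagonal dV')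
                      (JW (↥(maximalRealSubfield L)) L a) (complexConj_imagUnit L) (imagUnit_ne_zero L) (imagUnit_mul_self L) (realDiagonal_isSymm L dV' hdV')
                      (isSymm_TW (↥(maximalRealSubfield L)) a) (isUnit_det_realDiagonal L dV' hdV' hdV'0) (isUnit_det_TW (↥(maximalRealSubfield L)) a)
                      (realDiagonal_map L dV' hdV').symm (JW_eq (↥(maximalRealSubfield L)) L a)
                      (isCompatible_chiSplittingLine L e dV' hdV' hdV'0 (toHeckeCharacter L μ) (isUnitary_toHeckeCharacter L μ)
                        ((isOscillatorChar_toHeckeCharacter_iff μ).mpr hμ) (TW (↥(maximalRealSubfield L)) a) (isSymm_TW (↥(maximalRealSubfield L)) a)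
                        (isUnit_det_TW (↥(maximalRealSubfield L)) a) (JW (↥(maximalRealSubfield L)) L a) (JW_eq (↥(maximalRealSubfield L)) L a)))
                    (1, a') (schwartzReindexCLM (↥(maximalRealSubfield L)) e (φ j₀)) = schwartzReindexCLM (↥(maximalRealSubfield L)) e (φ j₀))) :
        ∀ {n' : ℕ} (e₁ : Fin 3 × Fin 1 ≃ Fin n') (dV : Fin 3 → L) (hdV : ∀ i, IsCMField.complexConj L (dV i) = dV i)
          (hdV0 : ∀ i, dV i ≠ 0) (g : GL (Fin 3) L)
          (hg : ((g : Matrix (Fin 3) (Fin 3) L).map (cmConjRingHom L))ᵀ * H * (g : Matrix (Fin 3) (Fin 3) L) = Matrix.diagonal dV)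
          (ιV : finAdelic (↥(maximalRealSubfield L)) L (IsCMField.complexConj L) 3 H →*
              finAdelic (↥(maximalRealSubfield L)) L (IsCMField.complexConj L) 3 (Matrix.diagonal dV)),
            (∀ k, ((ιV k : finAdelic (↥(maximalRealSubfield L)) L (IsCMField.complexConj L) 3 (Matrix.diagonal dV)) :
                GL (Fin 3) (FiniteAdeleRing (𝓞 L) L)) =
              (toFinAdeleGL L 3 g)⁻¹ * (k : GL (Fin 3) (FiniteAdeleRing (𝓞 L) L)) * toFinAdeleGL L 3 g) →
          ∀ [CompactSpace (↥(UnitaryGroup.adelic (↥(maximalRealSubfield L)) L (IsCMField.complexConj L) 3 (Matrix.diagonal dV)) ⧸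
              (UnitaryGroup.toAdelic (↥(maximalRealSubfield L)) L (IsCMField.complexConj L) 3 (Matrix.diagonal dV)).range)],
          ∀ (μ : Literature.NumberTheory.Automorphic.IdeleClassGroup L →ₜ* Circle) (hμ : IsConjugateSymplectic L μ), HasWeight L μ 1 →
            ι ∈ hμ.cmType.1 →
          ∀ (a : (↥(maximalRealSubfield L))ˣ) (χ : Chi (↥(maximalRealSubfield L)) L (IsCMField.complexConj L)),
              IsAdmissibleElement L hμ.cmType.1 (algebraMap (↥(maximalRealSubfield L)) L a * (2 * imagUnit L)⁻¹) →
              ∀ (hρ : HasThetaMajorants fun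
                  (p : ↥(UnitaryGroup.adelic (↥(maximalRealSubfield L)) L (IsCMField.complexConj L) 3 (Matrix.diagonal dV)) ×
                    ↥(UnitaryGroup.adelic (↥(maximalRealSubfield L)) L (IsCMField.complexConj L) 1 (JW (↥(maximalRealSubfield L)) L a)))
                  (Φ : piSchwartzBruhat (↥(maximalRealSubfield L)) (Fin n')) =>
                    pairRep (↥(maximalRealSubfield L)) L (IsCMField.complexConj L) 3 1 e₁ (Matrix.diagonal dV) (JW (↥(maximalRealSubfield L)) L a)
                      (chiSplittingLine L e₁ dV hdV hdV0 (toHeckeCharacter L μ) (isUnitary_toHeckeCharacter L μ)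
                        ((isOscillatorChar_toHeckeCharacter_iff μ).mpr hμ) (TW (↥(maximalRealSubfield L)) a)
                        (isUnit_det_TW (↥(maximalRealSubfield L)) a) (JW (↥(maximalRealSubfield L)) L a) (JW_eq (↥(maximalRealSubfield L)) L a))
                      p Φ)
                [MeasurableSpace (↥(UnitaryGroup.adelic (↥(maximalRealSubfield L)) L (IsCMField.complexConj L) 1
                    (JW (↥(maximalRealSubfield L)) L a)) ⧸
                      (UnitaryGroup.toAdelic (↥(maximalRealSubfield L)) L (IsCMField.complexConj L) 1 (JW (↥(maximalRealSubfield L)) L a)).range)]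
                [BorelSpace (↥(UnitaryGroup.adelic (↥(maximalRealSubfield L)) L (IsCMField.complexConj L) 1
                    (JW (↥(maximalRealSubfield L)) L a)) ⧸
                      (UnitaryGroup.toAdelic (↥(maximalRealSubfield L)) L (IsCMField.complexConj L) 1 (JW (↥(maximalRealSubfield L)) L a)).range)]
                (μW : Measure (↥(UnitaryGroup.adelic (↥(maximalRealSubfield L)) L (IsCMField.complexConj L) 1
                  (JW (↥(maximalRealSubfield L)) L a)) ⧸
                    (UnitaryGroup.toAdelic (↥(maximalRealSubfield L)) L (IsCMField.complexConj L) 1 (JW (↥(maximalRealSubfield L)) L a)).range))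
                [IsFiniteMeasure μW]
                [SMulInvariantMeasure
                  (↥(UnitaryGroup.adelic (↥(maximalRealSubfield L)) L (IsCMField.complexConj L) 1 (JW (↥(maximalRealSubfield L)) L a)))
                  (↥(UnitaryGroup.adelic (↥(maximalRealSubfield L)) L (IsCMField.complexConj L) 1 (JW (↥(maximalRealSubfield L)) L a)) ⧸
                    (UnitaryGroup.toAdelic (↥(maximalRealSubfield L)) L (IsCMField.complexConj L) 1 (JW (↥(maximalRealSubfield L)) L a)).range)
                  μW]
                [μW.IsOpenPosMeasure],
              ∃ (φ : Fin 2 → 𝓢(((Fin 3 × Fin 1) → NumberField.mixedEmbedding.mixedSpace ↥(maximalRealSubfield L)), ℂ)) (j₀ : Fin 2),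
                  -- (HOLCOT) every theta pair of `φ` read on `U(H)(𝔸)` along the canonical transport is a HOLOMORPHIC COTANGENT FORM at `(ι, T)` …
                (haveI := normal_range_toAdelic_JW L a
                 ∀ (Φf : FinSB (↥(maximalRealSubfield L)) (Fin 3 × Fin 1)),
                    ((fun (x : (adelicGroupData (↥(maximalRealSubfield L)) L (IsCMField.complexConj L) 3 H).Adelic) (j : Fin 2) =>
                      (lineThetaKernelDatum L 3 e₁ dV hdV hdV0 μ hμ a hρ).thetaLiftFun μW
                        (piSBReindex (↥(maximalRealSubfield L)) e₁
                          (piSchwartzBruhatEquiv (↥(maximalRealSubfield L)) (Fin 3 × Fin 1) (φ j ⊗ₜ[ℂ] Φf)))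
                        (charCM (chiQuot (↥(maximalRealSubfield L)) L (IsCMField.complexConj L) (Algebra.IsQuadraticExtension.finrank_eq_two _ L)
                          (IsCMField.complexConj_ne_one (K := L)) a χ))
                        ((cmAdelicFrameTransport L 3 H dV g hg) x))) ∈
                      CotangentForms.holCotForms (↥(maximalRealSubfield L)) L (IsCMField.complexConj L) 3 H
                        (cmArchSection L ι H T hT) (cmCompactFactor L ι H T hT)) ∧
                  -- … the archimedean vector `R^∞_{e₁} φ_{j₀}` is non-zero …
                schwartzReindexCLM (↥(maximalRealSubfield L)) e₁ (φ j₀) ≠ 0 ∧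
                  -- (E) … and FIXED by `U(⟨a⟩)(L⁺ ⊗ ℝ)` under the archimedean Weil representation at the `μ`-splitting
                (∀ a' : UnitaryGroup.arch (↥(maximalRealSubfield L)) L (IsCMField.complexConj L) 1 (JW (↥(maximalRealSubfield L)) L a),
                  HodgeCM.Model.HypCensus.archWeilRep (↥(maximalRealSubfield L)) L (IsCMField.complexConj L) 3 1 (Matrix.diagonal dV)
                    (JW (↥(maximalRealSubfield L)) L a) (complexConj_imagUnit L) (imagUnit_ne_zero L) (imagUnit_mul_self L) (realDiagonal_isSymm L dV hdV)
                    (isSymm_TW (↥(maximalRealSubfield L)) a) (isUnit_det_realDiagonal L dV hdV hdV0) (isUnit_det_TW (↥(maximalRealSubfield L)) a)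
                    (realDiagonal_map L dV hdV).symm (JW_eq (↥(maximalRealSubfield L)) L a) e₁
                    (chiSplittingLine L e₁ dV hdV hdV0 (toHeckeCharacter L μ) (isUnitary_toHeckeCharacter L μ)
                      ((isOscillatorChar_toHeckeCharacter_iff μ).mpr hμ) (TW (↥(maximalRealSubfield L)) a)
                      (isUnit_det_TW (↥(maximalRealSubfield L)) a) (JW (↥(maximalRealSubfield L)) L a) (JW_eq (↥(maximalRealSubfield L)) L a))
                    (ThetaNonvanishing.proj_apply_eq_toSp (↥(maximalRealSubfield L)) L (IsCMField.complexConj L) 3 1 e₁ (Matrix.diagonal dV)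
                      (JW (↥(maximalRealSubfield L)) L a) (complexConj_imagUnit L) (imagUnit_ne_zero L) (imagUnit_mul_self L) (realDiagonal_isSymm L dV hdV)
                      (isSymm_TW (↥(maximalRealSubfield L)) a) (isUnit_det_realDiagonal L dV hdV hdV0) (isUnit_det_TW (↥(maximalRealSubfield L)) a)
                      (realDiagonal_map L dV hdV).symm (JW_eq (↥(maximalRealSubfield L)) L a)
                      (isCompatible_chiSplittingLine L e₁ dV hdV hdV0 (toHeckeCharacter L μ) (isUnitary_toHeckeCharacter L μ)
                        ((isOscillatorChar_toHeckeCharacter_iff μ).mpr hμ) (TW (↥(maximalRealSubfield L)) a) (isSymm_TW (↥(maximalRealSubfield L)) a)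
                        (isUnit_det_TW (↥(maximalRealSubfield L)) a) (JW (↥(maximalRealSubfield L)) L a) (JW_eq (↥(maximalRealSubfield L)) L a)))
                    (1, a') (schwartzReindexCLM (↥(maximalRealSubfield L)) e₁ (φ j₀)) = schwartzReindexCLM (↥(maximalRealSubfield L)) e₁ (φ j₀)) := by
  intro n' e₁ dV hdV hdV0 g hg ιV hιV _instC μ hμ hw hι a χ hadm hρ _instM _instB μW _instF _instS _instO
  classical
  haveI hN := normal_range_toAdelic_JW L a
  /- STEP 0: the source frame — compactness, majorants, the finite-adelic transport; the source clause -/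
  haveI hC' : CompactSpace (↥(UnitaryGroup.adelic (Fp L) L (IsCMField.complexConj L) 3 (Matrix.diagonal dV')) ⧸ (UnitaryGroup.toAdelic (Fp L) L (IsCMField.complexConj L) 3 (Matrix.diagonal dV')).range) :=
    compactSpace_quotient_diagonalFrame ι hpos hdeg hg'
  have hρ' := hasThetaMajorants_lineThetaKernelDatum_of_frame L ι H e dV' hdV' hdV'0 g' hg' hpos μ hμ a
  have h1' : formCongr ((IsCMField.complexConj L : L ≃ₐ[Fp L] L) : L →+* L) g' ((1 : L) • H) = Matrix.diagonal dV' := by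
    rw [one_smul]; exact hg'
  obtain ⟨φ', j₀, hHol', hne', hE'⟩ := hsrc
    ((finAdelicCongr (Fp L) L (IsCMField.complexConj L) g' one_ne_zero h1').symm.toMulEquiv.toMonoidHom) (fun _ => rfl) μ hμ hw hι a χ hadm hρ' μW
  /- STEP 1: the rational isometry `B = g′⁻¹ g : (V, diag dV) ≅ (V, diag dV′)` -/
  obtain ⟨B, hBdef⟩ : ∃ B : GL (Fin 3) L, B = g'⁻¹ * g := ⟨_, rfl⟩
  have hB : formCongr ((IsCMField.complexConj L : L ≃ₐ[Fp L] L) : L →+* L) B ((1 : L) • Matrix.diagonal dV') = Matrix.diagonal dV := by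
    rw [one_smul, hBdef]
    show ((((g'⁻¹ * g : GL (Fin 3) L)) : Matrix (Fin 3) (Fin 3) L).map (cmConjRingHom L))ᵀ * Matrix.diagonal dV' *
      ((g'⁻¹ * g : GL (Fin 3) L) : Matrix (Fin 3) (Fin 3) L) = Matrix.diagonal dV
    have h1 : (((g' : GL (Fin 3) L) : Matrix (Fin 3) (Fin 3) L).map (cmConjRingHom L)) *
        (((g'⁻¹ : GL (Fin 3) L) : Matrix (Fin 3) (Fin 3) L).map (cmConjRingHom L)) = 1 := by
      rw [← Matrix.map_mul, ← Units.val_mul, mul_inv_cancel, Units.val_one, Matrix.map_one _ (map_zero _) (map_one _)]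
    have h2 : ((g' : GL (Fin 3) L) : Matrix (Fin 3) (Fin 3) L) * ((g'⁻¹ : GL (Fin 3) L) : Matrix (Fin 3) (Fin 3) L) = 1 := by
      rw [← Units.val_mul, mul_inv_cancel, Units.val_one]
    rw [← hg', ← hg, Units.val_mul, Matrix.map_mul, Matrix.transpose_mul]
    calc (((g : GL (Fin 3) L) : Matrix (Fin 3) (Fin 3) L).map (cmConjRingHom L))ᵀ *
            (((g'⁻¹ : GL (Fin 3) L) : Matrix (Fin 3) (Fin 3) L).map (cmConjRingHom L))ᵀ *
          ((((g' : GL (Fin 3) L) : Matrix (Fin 3) (Fin 3) L).map (cmConjRingHom L))ᵀ * H * ((g' : GL (Fin 3) L) : Matrix (Fin 3) (Fin 3) L)) *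
          (((g'⁻¹ : GL (Fin 3) L) : Matrix (Fin 3) (Fin 3) L) * ((g : GL (Fin 3) L) : Matrix (Fin 3) (Fin 3) L))
        = (((g : GL (Fin 3) L) : Matrix (Fin 3) (Fin 3) L).map (cmConjRingHom L))ᵀ *
            ((((g' : GL (Fin 3) L) : Matrix (Fin 3) (Fin 3) L).map (cmConjRingHom L)) *
              (((g'⁻¹ : GL (Fin 3) L) : Matrix (Fin 3) (Fin 3) L).map (cmConjRingHom L)))ᵀ * H *
          ((((g' : GL (Fin 3) L) : Matrix (Fin 3) (Fin 3) L) * ((g'⁻¹ : GL (Fin 3) L) : Matrix (Fin 3) (Fin 3) L)) *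
            ((g : GL (Fin 3) L) : Matrix (Fin 3) (Fin 3) L)) := by
          rw [Matrix.transpose_mul]; simp only [Matrix.mul_assoc]
      _ = _ := by rw [h1, h2, Matrix.transpose_one, Matrix.mul_one, Matrix.one_mul]
  -- `θ_V := Ad(a)`, `a = B⁻¹ ⊗ 1`, and `θ_V ∘ T_{g′} = T_g`
  have hθT : ∀ x : (adelicGroupData (Fp L) L (IsCMField.complexConj L) 3 H).Adelic,
      (adelicIsometryConj (Fp L) L (IsCMField.complexConj L) 3 (aOfB L B) (aOfB_isometry L dV dV' B hB)) (cmAdelicFrameTransport L 3 H dV' g' hg' x) = cmAdelicFrameTransport L 3 H dV g hg x := fun x => by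
    refine Subtype.ext ?_
    rw [coe_adelicIsometryConj, coe_cmAdelicFrameTransport, coe_cmAdelicFrameTransport]
    show toAdeleGL L B⁻¹ * _ * (toAdeleGL L B⁻¹)⁻¹ = _
    rw [hBdef]
    simp only [map_mul, map_inv, mul_inv_rev, inv_inv]
    group
  /- STEP 2: the frame-transport operator `R` of `B` (part 1 ★ `exists_lineFrameTransportOperator`): Θ-fixing, intertwining over `(θ_V, id)`, `A ⊗ Q` on pure tensors -/
  obtain ⟨R, A, Q, hΘ, hR, hRtmul⟩ := exists_lineFrameTransportOperator L e e₁ dV' hdV' hdV'0 dV hdV hdV0 B hB μ hμ a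
  /- STEP 3: the pointwise identity of the lifts (part 1 §1) read along the two frame transports -/
  have hlift : ∀ (Φ : piSchwartzBruhat (Fp L) (Fin n)) (x : (adelicGroupData (Fp L) L (IsCMField.complexConj L) 3 H).Adelic),
      (lineThetaKernelDatum L 3 e dV' hdV' hdV'0 μ hμ a hρ').thetaLiftFun μW Φ
          (charCM (chiQuot (Fp L) L (IsCMField.complexConj L) (Algebra.IsQuadraticExtension.finrank_eq_two _ L) (IsCMField.complexConj_ne_one (K := L)) a χ))
          (cmAdelicFrameTransport L 3 H dV' g' hg' x) =
        (lineThetaKernelDatum L 3 e₁ dV hdV hdV0 μ hμ a hρ).thetaLiftFun μW (R Φ)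
          (charCM (chiQuot (Fp L) L (IsCMField.complexConj L) (Algebra.IsQuadraticExtension.finrank_eq_two _ L) (IsCMField.complexConj_ne_one (K := L)) a χ))
          (cmAdelicFrameTransport L 3 H dV g hg x) := fun Φ x => by
    rw [← hθT x]
    exact lineThetaLiftFun_eq_of_intertwiner L 3 e e₁ dV' hdV' hdV'0 dV hdV hdV0 μ hμ a (adelicIsometryConj (Fp L) L (IsCMField.complexConj L) 3 (aOfB L B) (aOfB_isometry L dV dV' B hB)) R hΘ hR hρ' hρ μW _ Φ _
  /- STEP 4: the witnesses `φ := A ∘ φ′`, `j₀` -/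
  refine ⟨fun j => A (φ' j), j₀, ?_, ?_, ?_⟩
  · -- (HOLCOT): the theta pair at `(e₁, dV, g)` with `(A φ′_j, Φ_f)` IS the theta pair at `(e, dV′, g′)` with `(φ′_j, Q⁻¹ Φ_f)`
    intro Φf
    have hfun : (fun (x : (adelicGroupData (Fp L) L (IsCMField.complexConj L) 3 H).Adelic) (j : Fin 2) =>
        (lineThetaKernelDatum L 3 e₁ dV hdV hdV0 μ hμ a hρ).thetaLiftFun μW
          (piSBReindex (Fp L) e₁ (piSchwartzBruhatEquiv (Fp L) (Fin 3 × Fin 1) ((fun j => A (φ' j)) j ⊗ₜ[ℂ] Φf)))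
          (charCM (chiQuot (Fp L) L (IsCMField.complexConj L) (Algebra.IsQuadraticExtension.finrank_eq_two _ L) (IsCMField.complexConj_ne_one (K := L)) a χ))
          (cmAdelicFrameTransport L 3 H dV g hg x)) =
        fun (x : (adelicGroupData (Fp L) L (IsCMField.complexConj L) 3 H).Adelic) (j : Fin 2) =>
        (lineThetaKernelDatum L 3 e dV' hdV' hdV'0 μ hμ a hρ').thetaLiftFun μW
          (piSBReindex (Fp L) e (piSchwartzBruhatEquiv (Fp L) (Fin 3 × Fin 1) (φ' j ⊗ₜ[ℂ] Q.symm Φf)))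
          (charCM (chiQuot (Fp L) L (IsCMField.complexConj L) (Algebra.IsQuadraticExtension.finrank_eq_two _ L) (IsCMField.complexConj_ne_one (K := L)) a χ))
          (cmAdelicFrameTransport L 3 H dV' g' hg' x) := by
      funext x j
      rw [hlift, hRtmul, LinearEquiv.apply_symm_apply]
    rw [hfun]
    exact hHol' (Q.symm Φf)
  · -- `R^∞_{e₁} (A φ′_{j₀}) ≠ 0`: `R^∞_{e₁}` and `A` are injective, `R^∞_e φ′_{j₀} ≠ 0`
    intro h0
    apply hne'
    have hinj : ∀ ψ : 𝓢(((Fin 3 × Fin 1) → mixedSpace (Fp L)), ℂ), schwartzReindexCLM (Fp L) e₁ ψ = 0 → ψ = 0 := fun ψ hψ => by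
      have h := congrArg (schwartzReindexCLM (Fp L) e₁.symm) hψ
      rw [map_zero] at h
      rw [← h]
      ext w
      simp only [schwartzReindexCLM_apply, Function.comp_assoc, Equiv.symm_comp_self, Function.comp_id]
    have h1 : φ' j₀ = 0 := by
      have h2 : A (φ' j₀) = 0 := hinj _ h0
      exact A.injective (h2.trans (map_zero A).symm)
    show schwartzReindexCLM (Fp L) e (φ' j₀) = 0
    rw [h1, map_zero]
  · -- (E): the intertwining identity at `(1, a′_∞)` read on the archimedean factor
    intro a'
    -- a nonzero finite test function (indicator of the box `(𝒪̂)^ι`)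
    obtain ⟨f₀, hf₀⟩ : ∃ f₀ : FinSB (Fp L) (Fin 3 × Fin 1), f₀ ≠ 0 := by
      refine ⟨⟨_, indicator_thinCoset_mem_schwartzBruhat (Fp L) (Fin 3 × Fin 1) 0 ⊤ 1⟩, fun h => ?_⟩
      have h1 := congrArg (fun f : FinSB (Fp L) (Fin 3 × Fin 1) => (f : (Fin 3 × Fin 1 → FiniteAdeleRing (𝓞 (Fp L)) (Fp L)) → ℂ) 0) h
      have h2 : ((0 : Fin 3 × Fin 1 → FiniteAdeleRing (𝓞 (Fp L)) (Fp L)) +ᵥ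
          (piLevelIdeal (Fp L) (Fin 3 × Fin 1) ⊤ : Set (Fin 3 × Fin 1 → FiniteAdeleRing (𝓞 (Fp L)) (Fp L)))).indicator
          (fun _ => (1 : ℂ)) 0 = 1 :=
        indicator_vadd_addSubgroup_of_mem _ _ _ (by rw [neg_zero, zero_add]; exact zero_mem _)
      exact one_ne_zero (h2.symm.trans h1)
    have hf₁ : finSBReindex (Fp L) e₁ (Q f₀) ≠ 0 := fun h =>
      hf₀ (Q.injective ((((finSBReindex (Fp L) e₁).map_eq_zero_iff).1 h).trans (map_zero Q).symm))
    -- the archimedean pair `(1, a′)` pushed into the adelic pair: `(1_𝔸, a′_∞ ⊗ 1_f)`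
    obtain ⟨u, hPu⟩ : ∃ u : ↥(UnitaryGroup.adelic (Fp L) L (IsCMField.complexConj L) 1 (JW (Fp L) L a)), ∀ D : Fin 3 → L,
        HodgeCM.Model.HypCensus.archProdHom (Fp L) L (IsCMField.complexConj L) 3 1 (Matrix.diagonal D) (JW (Fp L) L a) (1, a') = (1, u) :=
      ⟨(HodgeCM.Model.HypCensus.archProdHom (Fp L) L (IsCMField.complexConj L) 3 1 (Matrix.diagonal dV) (JW (Fp L) L a) (1, a')).2, fun D =>
        Prod.ext (by
          show (UnitaryGroup.archToAdelic (Fp L) L (IsCMField.complexConj L) 3 (Matrix.diagonal D)) 1 = 1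
          exact map_one _) rfl⟩
    have hθ1 : (adelicIsometryConj (Fp L) L (IsCMField.complexConj L) 3 (aOfB L B) (aOfB_isometry L dV dV' B hB)) 1 = 1 := map_one _
    -- LEFT: at the source frame the pure tensor `R_e(φ′_{j₀} ⊗ f₀)` is FIXED by `(1, a′_∞)` ((E) at the source)
    have hL : pairRep (Fp L) L (IsCMField.complexConj L) 3 1 e (Matrix.diagonal dV') (JW (Fp L) L a) (chiSplittingLine L e dV' hdV' hdV'0 (toHeckeCharacter L μ) (isUnitary_toHeckeCharacter L μ) ((isOscillatorChar_toHeckeCharacter_iff μ).mpr hμ) (TW (Fp L) a) (isUnit_det_TW (Fp L) a) (JW (Fp L) L a) (JW_eq (Fp L) L a)) (1, u)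
        (piSBReindex (Fp L) e (piSchwartzBruhatEquiv (Fp L) (Fin 3 × Fin 1) (φ' j₀ ⊗ₜ[ℂ] f₀))) =
        piSBReindex (Fp L) e (piSchwartzBruhatEquiv (Fp L) (Fin 3 × Fin 1) (φ' j₀ ⊗ₜ[ℂ] f₀)) := by
      rw [← hPu dV', piSBReindex_tmul, pairRep_apply, HodgeCM.Model.HypCensus.omega_pairSplitting_arch_map_tmul (Fp L) L (IsCMField.complexConj L) 3 1 (Matrix.diagonal dV') (JW (Fp L) L a) (complexConj_imagUnit L) (imagUnit_ne_zero L) (imagUnit_mul_self L) (realDiagonal_isSymm L dV' hdV') (isSymm_TW (Fp L) a) (isUnit_det_realDiagonal L dV' hdV' hdV'0) (isUnit_det_TW (Fp L) a) (realDiagonal_map L dV' hdV').symm (JW_eq (Fp L) L a) e (chiSplittingLine L e dV' hdV' hdV'0 (toHeckeCharacter L μ) (isUnitary_toHeckeCharacter L μ) ((isOscillatorChar_toHeckeCharacter_iff μ).mpr hμ) (TW (Fp L) a) (isUnit_det_TW (Fp L) a) (JW (Fp L) L a) (JW_eq (Fp L) L a)) (ThetaNonvanishing.proj_apply_eq_toSp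 (Fp L) L (IsCMField.complexConj L) 3 1 e (Matrix.diagonal dV') (JW (Fp L) L a) (complexConj_imagUnit L) (imagUnit_ne_zero L) (imagUnit_mul_self L) (realDiagonal_isSymm L dV' hdV') (isSymm_TW (Fp L) a) (isUnit_det_realDiagonal L dV' hdV' hdV'0) (isUnit_det_TW (Fp L) a) (realDiagonal_map L dV' hdV').symm (JW_eq (Fp L) L a) (isCompatible_chiSplittingLine L e dV' hdV' hdV'0 (toHeckeCharacter L μ) (isUnitary_toHeckeCharacter L μ) ((isOscillatorChar_toHeckeCharacter_iff μ).mpr hμ) (TW (Fp L) a) (isSymm_TW (Fp L) a) (isUnit_det_TW (Fp L) a) (JW (Fp L) L a) (JW_eq (Fp L) L a))) (1, a'), hE' a']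
    -- RIGHT: at the target frame `(1, a′_∞)` acts on the archimedean factor of `R (R_e(φ′_{j₀} ⊗ f₀)) = R_{e₁}(A φ′_{j₀}) ⊗ R^f_{e₁}(Q f₀)`
    have hRΨ : R (piSBReindex (Fp L) e (piSchwartzBruhatEquiv (Fp L) (Fin 3 × Fin 1) (φ' j₀ ⊗ₜ[ℂ] f₀))) =
        piSchwartzBruhatEquiv (Fp L) (Fin n') (schwartzReindexCLM (Fp L) e₁ (A (φ' j₀)) ⊗ₜ[ℂ] finSBReindex (Fp L) e₁ (Q f₀)) := by
      rw [hRtmul, piSBReindex_tmul]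
    have hRt : pairRep (Fp L) L (IsCMField.complexConj L) 3 1 e₁ (Matrix.diagonal dV) (JW (Fp L) L a) (chiSplittingLine L e₁ dV hdV hdV0 (toHeckeCharacter L μ) (isUnitary_toHeckeCharacter L μ) ((isOscillatorChar_toHeckeCharacter_iff μ).mpr hμ) (TW (Fp L) a) (isUnit_det_TW (Fp L) a) (JW (Fp L) L a) (JW_eq (Fp L) L a)) (1, u)
        (piSchwartzBruhatEquiv (Fp L) (Fin n') (schwartzReindexCLM (Fp L) e₁ (A (φ' j₀)) ⊗ₜ[ℂ] finSBReindex (Fp L) e₁ (Q f₀))) =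
        piSchwartzBruhatEquiv (Fp L) (Fin n')
          (HodgeCM.Model.HypCensus.archWeilRep (Fp L) L (IsCMField.complexConj L) 3 1 (Matrix.diagonal dV) (JW (Fp L) L a) (complexConj_imagUnit L) (imagUnit_ne_zero L) (imagUnit_mul_self L) (realDiagonal_isSymm L dV hdV) (isSymm_TW (Fp L) a) (isUnit_det_realDiagonal L dV hdV hdV0) (isUnit_det_TW (Fp L) a) (realDiagonal_map L dV hdV).symm (JW_eq (Fp L) L a) e₁ (chiSplittingLine L e₁ dV hdV hdV0 (toHeckeCharacter L μ) (isUnitary_toHeckeCharacter L μ) ((isOscillatorChar_toHeckeCharacter_iff μ).mpr hμ) (TW (Fp L) a) (isUnit_det_TW (Fp L) a) (JW (Fp L) L a) (JW_eq (Fp L) L a)) (ThetaNonvanishing.proj_apply_eq_toSp (Fp L) L (IsCMField.complexConj L) 3 1 e₁ (Matrix.diagonal dV) (JW (Fp L) L a) (complexConj_imagUnit L) (imagUnit_ne_zero L) (imagUnit_mul_self L) (realDiagonal_isSymm L dV hdV) (isSymm_TW (Fp L) a) (isUnit_det_realDiagonal L dV hdV hdV0) (isUnit_det_TW (Fp L)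 a) (realDiagonal_map L dV hdV).symm (JW_eq (Fp L) L a) (isCompatible_chiSplittingLine L e₁ dV hdV hdV0 (toHeckeCharacter L μ) (isUnitary_toHeckeCharacter L μ) ((isOscillatorChar_toHeckeCharacter_iff μ).mpr hμ) (TW (Fp L) a) (isSymm_TW (Fp L) a) (isUnit_det_TW (Fp L) a) (JW (Fp L) L a) (JW_eq (Fp L) L a))) (1, a') (schwartzReindexCLM (Fp L) e₁ (A (φ' j₀))) ⊗ₜ[ℂ] finSBReindex (Fp L) e₁ (Q f₀)) := by
      rw [← hPu dV, pairRep_apply, HodgeCM.Model.HypCensus.omega_pairSplitting_arch_map_tmul (Fp L) L (IsCMField.complexConj L) 3 1 (Matrix.diagonal dV) (JW (Fp L) L a) (complexConj_imagUnit L) (imagUnit_ne_zero L) (imagUnit_mul_self L) (realDiagonal_isSymm L dV hdV) (isSymm_TW (Fp L) a) (isUnit_det_realDiagonal L dV hdV hdV0) (isUnit_det_TW (Fp L) a) (realDiagonal_map L dV hdV).symm (JW_eq (Fp L) L a) e₁ (chiSplittingLine L e₁ dV hdV hdV0 (toHeckeCharacter L μ) (isUnitary_toHeckeCharacter L μ)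 ((isOscillatorChar_toHeckeCharacter_iff μ).mpr hμ) (TW (Fp L) a) (isUnit_det_TW (Fp L) a) (JW (Fp L) L a) (JW_eq (Fp L) L a)) (ThetaNonvanishing.proj_apply_eq_toSp (Fp L) L (IsCMField.complexConj L) 3 1 e₁ (Matrix.diagonal dV) (JW (Fp L) L a) (complexConj_imagUnit L) (imagUnit_ne_zero L) (imagUnit_mul_self L) (realDiagonal_isSymm L dV hdV) (isSymm_TW (Fp L) a) (isUnit_det_realDiagonal L dV hdV hdV0) (isUnit_det_TW (Fp L) a) (realDiagonal_map L dV hdV).symm (JW_eq (Fp L) L a) (isCompatible_chiSplittingLine L e₁ dV hdV hdV0 (toHeckeCharacter L μ) (isUnitary_toHeckeCharacter L μ) ((isOscillatorChar_toHeckeCharacter_iff μ).mpr hμ) (TW (Fp L) a) (isSymm_TW (Fp L) a) (isUnit_det_TW (Fp L) a) (JW (Fp L) L a) (JW_eq (Fp L) L a))) (1, a')]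
    have key := hR 1 u (piSBReindex (Fp L) e (piSchwartzBruhatEquiv (Fp L) (Fin 3 × Fin 1) (φ' j₀ ⊗ₜ[ℂ] f₀)))
    rw [hθ1, hL, hRΨ, hRt] at key
    -- cancel the (non-zero) finite factor
    obtain ⟨b, hb⟩ : ∃ b, (finSBReindex (Fp L) e₁ (Q f₀) : (Fin n' → FiniteAdeleRing (𝓞 (Fp L)) (Fp L)) → ℂ) b ≠ 0 := by
      by_contra hcon
      push Not at hcon
      exact hf₁ (Subtype.ext (funext hcon))
    ext y
    have hv := congrArg (fun Φ : piSchwartzBruhat (Fp L) (Fin n') => (Φ : (Fin n' → AdeleRing (𝓞 (Fp L)) (Fp L)) → ℂ)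
      (piAdeleSplit (Fp L) (Fin n') (y, b))) key
    simp only [coe_piSchwartzBruhatEquiv_tmul, piArch_piAdeleSplit, piFinite_piAdeleSplit] at hv
    exact (mul_right_cancel₀ hb hv).symm

end Summit.HodgeConjecture.HodgeConjecture.Cruxes.H413.K2E2CapArchPairFrameTransport

end
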